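import Literature.AlgebraicGeometry.Motives.AbelianVarietySimpleFactorsUnique
import Literature.AlgebraicGeometry.Motives.BaseChangeAlongInverse
import HarnessLib

/-!
# `End⁰(A)` is an isogeny invariant: `A ∼ B ⟹ End⁰(A) ≅ End⁰(B)` as `ℚ`-algebras (any field)

D. Mumford, *Abelian Varieties* (1970), §19, Remark p. 169 and «The structure of `End⁰(X)`»
(p. 172 ff.): an isogeny `u : A → B` has a quasi-inverse `v : B → A`, `v u = [n]_A`, `u v = [n]_B`,
so `u` becomes invertible in the category of abelian varieties up to isogeny (`Hom⁰ = ℚ ⊗ Hom`) and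
`α ↦ u α u⁻¹ = n⁻¹ · (u α v)` is an isomorphism `End⁰(A) ≅ End⁰(B)` of `ℚ`-algebras; J. S. Milne,
*Abelian Varieties* (Cornell–Silverman 1986), §12 p. 122 (the isogeny category; `End⁰` depends only on
the isogeny class).  The tree had this only for elliptic curves, by a dimension count
(`CorCM/Assembly/CMEllipticCurvesIsogenyFields`, `nonempty_algEquiv_endAlgebra_of_isIsogenous` with
`dim = 1`); this file PROVES it for all abelian varieties over an ARBITRARY field `K`, on the tree's
carriers `AbelianVariety K`, `End⁰(A) = A.endAlgebra = ℚ ⊗_ℤ End A`: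

* `exists_endAlgebra_algEquiv_of_nsmul_inverse` — for `u : A → B`, `v : B → A`, `n ≥ 1` with
  `u ≫ v = n • 𝟙_A`, `v ≫ u = n • 𝟙_B` there is `e : End⁰(A) ≃ₐ[ℚ] End⁰(B)` with
  `e (1 ⊗ α) = n⁻¹ · (1 ⊗ (v ≫ α ≫ u))` and `e⁻¹ (1 ⊗ β) = n⁻¹ · (1 ⊗ (u ≫ β ≫ v))` (conjugation
  by `u` in the isogeny category; the ring homomorphism `End A → End⁰(B)` is extended to
  `ℚ ⊗_ℤ End A` by `Algebra.TensorProduct.lift`, exactly as the tree's rational representation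
  `ComplexMultiplication.bettiRep`);
* `IsIsogeny.nonempty_endAlgebra_algEquiv`, `IsIsogenous.nonempty_endAlgebra_algEquiv` — **`A ∼ B`
  gives `End⁰(A) ≃ₐ[ℚ] End⁰(B)`** (quasi-inverse from the tree's THEOREM
  `IsIsogeny.exists_nsmul_inverse_holds`, Mumford §19 Remark p. 169);
* consequences: `IsIsogenous.finrank_endAlgebra_eq` (`[End⁰(A) : ℚ] = [End⁰(B) : ℚ]`),
  `IsIsogenous.isField_endAlgebra_iff` (`End⁰(A)` is a field iff `End⁰(B)` is),
  `IsIsogenous.endAlgebra_comm_iff` (commutativity is an isogeny invariant).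

Theorems only; no definition, no named fact (D-0026).

## References
* [MumfordAV1970] D. Mumford, *Abelian Varieties*, TIFR Studies in Math. 5 (1970), §19 Remark p. 169
  (quasi-inverse of an isogeny), pp. 172–174 (structure of `End⁰`); not held, cited through Milne 1986.
* [Milne1986AbelianVarieties] J. S. Milne, *Abelian Varieties*, in Cornell–Silverman, *Arithmetic
  Geometry* (1986), §12 p. 122 (held `book:cornellnd-arithmetic-geometry`, PDF p. 189).

## Design
Mathlib used: `Algebra.TensorProduct.lift`, `Algebra.TensorProduct.lift_tmul`, `AlgEquiv.ofAlgHom`,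
`MulEquiv.isField`, `LinearEquiv.finrank_eq`.  Elements of `End⁰` are handled through the tree's
normal form `endAlgebra.exists_eq_algebraMap_mul_of` (`x = M⁻¹ · (1 ⊗ F)`).  `End A = (A ⟶ A)` with
`f * g = g ≫ f`; the conjugation is written on morphisms `v ≫ α ≫ u`.
-/

noncomputable section

universe u

open CategoryTheory

namespace Literature.AlgebraicGeometry.Motives

namespace AbelianVariety

variable {K : Type u} [Field K] {A B : AbelianVariety K}

/-- The algebra behind conjugation by an isogeny: for `u ≫ v = n • 𝟙_A`, the endomorphisms
`v α u`, `v β u` of `B` multiply (in `End B`, i.e. compose in reverse order) to `n · v (α β) u`.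
[cite: MumfordAV1970, §19 Remark p. 169] -/
theorem conj_mul_conj_eq_nsmul (u : A ⟶ B) (v : B ⟶ A) {n : ℕ} (huv : u ≫ v = n • 𝟙 A)
    (α β : End A) :
    End.of (v ≫ End.asHom α ≫ u) * End.of (v ≫ End.asHom β ≫ u) =
      n • End.of (v ≫ End.asHom (α * β) ≫ u) := by
  change (v ≫ End.asHom β ≫ u) ≫ (v ≫ End.asHom α ≫ u) = n • (v ≫ (End.asHom β ≫ End.asHom α) ≫ u)
  simp only [Category.assoc]
  rw [reassoc_of% huv, Preadditive.nsmul_comp, Category.id_comp, Preadditive.comp_nsmul,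
    Preadditive.comp_nsmul]

/-- `v 𝟙_A u = v u = n · 𝟙_B` in `End B`. [cite: MumfordAV1970, §19 Remark p. 169] -/
theorem conj_one_eq_nsmul (u : A ⟶ B) (v : B ⟶ A) {n : ℕ} (hvu : v ≫ u = n • 𝟙 B) :
    End.of (v ≫ End.asHom (1 : End A) ≫ u) = n • (1 : End B) := by
  change v ≫ 𝟙 A ≫ u = n • 𝟙 B
  rw [Category.id_comp, hvu]

/-- `u (v α u) v = n² · α` for `u ≫ v = n • 𝟙_A`. [cite: MumfordAV1970, §19 Remark p. 169] -/
theorem conj_conj_eq_nsmul (u : A ⟶ B) (v : B ⟶ A) {n : ℕ} (huv : u ≫ v = n • 𝟙 A) (α : End A) :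
    End.of (u ≫ End.asHom (End.of (v ≫ End.asHom α ≫ u)) ≫ v) = (n * n) • α := by
  change u ≫ (v ≫ End.asHom α ≫ u) ≫ v = (n * n) • End.asHom α
  simp only [Category.assoc]
  rw [reassoc_of% huv, huv, Preadditive.nsmul_comp, Category.id_comp, Preadditive.comp_nsmul,
    Category.comp_id, ← mul_nsmul']

/-- The conjugation `α ↦ n⁻¹ · (1 ⊗ (v ≫ α ≫ u))`, `End A → End⁰(B)`, is a ring homomorphism when
`u ≫ v = n • 𝟙_A` and `v ≫ u = n • 𝟙_B` (`(v α u)(v β u) = v α (u v) β u = n · v α β u`); packaged as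
the existence of a ring homomorphism with this formula (no definition is introduced).
[cite: MumfordAV1970, §19 Remark p. 169] -/
theorem exists_ringHom_endAlgebra_of_nsmul_inverse (u : A ⟶ B) (v : B ⟶ A) {n : ℕ} (hn : 0 < n)
    (huv : u ≫ v = n • 𝟙 A) (hvu : v ≫ u = n • 𝟙 B) :
    ∃ Φ : End A →+* B.endAlgebra, ∀ α : End A,
      Φ α = (n : ℚ)⁻¹ • endAlgebra.of B (End.of (v ≫ End.asHom α ≫ u)) := by
  have hn' : (n : ℚ) ≠ 0 := Nat.cast_ne_zero.2 hn.ne'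
  refine ⟨{ toFun := fun α => (n : ℚ)⁻¹ • endAlgebra.of B (End.of (v ≫ End.asHom α ≫ u))
            map_one' := ?_
            map_mul' := fun α β => ?_
            map_zero' := ?_
            map_add' := fun α β => ?_ }, fun α => rfl⟩
  · rw [conj_one_eq_nsmul u v hvu, map_nsmul, map_one, ← Nat.cast_smul_eq_nsmul ℚ, smul_smul,
      inv_mul_cancel₀ hn', one_smul]
  · -- `n⁻¹ (v (αβ) u) = n⁻¹ (v α u) · n⁻¹ (v β u)` by `conj_mul_conj_eq_nsmul`
    rw [smul_mul_assoc, mul_smul_comm, ← map_mul, conj_mul_conj_eq_nsmul u v huv, map_nsmul,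
      ← Nat.cast_smul_eq_nsmul ℚ, smul_smul, smul_smul]
    congr 1
    field_simp
  · have h0 : End.of (v ≫ End.asHom (0 : End A) ≫ u) = 0 := by
      change v ≫ 0 ≫ u = 0
      rw [Limits.zero_comp, Limits.comp_zero]
    rw [h0, map_zero, smul_zero]
  · have hadd : End.of (v ≫ End.asHom (α + β) ≫ u) =
        End.of (v ≫ End.asHom α ≫ u) + End.of (v ≫ End.asHom β ≫ u) := by
      change v ≫ (End.asHom α + End.asHom β) ≫ u = (v ≫ End.asHom α ≫ u) + (v ≫ End.asHom β ≫ u)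
      rw [Preadditive.add_comp, Preadditive.comp_add]
    rw [hadd, map_add, smul_add]

/-- **Conjugation by an isogeny with quasi-inverse data is an isomorphism `End⁰(A) ≅ End⁰(B)` of
`ℚ`-algebras**: for `u : A → B`, `v : B → A`, `n ≥ 1` with `u ≫ v = n • 𝟙_A`, `v ≫ u = n • 𝟙_B` there is
`e : End⁰(A) ≃ₐ[ℚ] End⁰(B)` with `e (1 ⊗ α) = n⁻¹ · (1 ⊗ (v ≫ α ≫ u))` and
`e⁻¹ (1 ⊗ β) = n⁻¹ · (1 ⊗ (u ≫ β ≫ v))`. [cite: MumfordAV1970, §19 Remark p. 169 and pp. 172–174] -/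
theorem exists_endAlgebra_algEquiv_of_nsmul_inverse (u : A ⟶ B) (v : B ⟶ A) {n : ℕ} (hn : 0 < n)
    (huv : u ≫ v = n • 𝟙 A) (hvu : v ≫ u = n • 𝟙 B) :
    ∃ e : A.endAlgebra ≃ₐ[ℚ] B.endAlgebra,
      (∀ α : End A, e (endAlgebra.of A α) =
        (n : ℚ)⁻¹ • endAlgebra.of B (End.of (v ≫ End.asHom α ≫ u))) ∧
      (∀ β : End B, e.symm (endAlgebra.of B β) =
        (n : ℚ)⁻¹ • endAlgebra.of A (End.of (u ≫ End.asHom β ≫ v))) := by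
  have hn' : (n : ℚ) ≠ 0 := Nat.cast_ne_zero.2 hn.ne'
  have hnn : (n : ℚ)⁻¹ * (n : ℚ)⁻¹ * ((n : ℚ) * n) = 1 := by field_simp
  obtain ⟨Φ₀, hΦ₀⟩ := exists_ringHom_endAlgebra_of_nsmul_inverse u v hn huv hvu
  obtain ⟨Ψ₀, hΨ₀⟩ := exists_ringHom_endAlgebra_of_nsmul_inverse v u hn hvu huv
  -- extend to `ℚ ⊗_ℤ End` (`ℤ`, `ℚ`, `End⁰` form a scalar tower: `endAlgebra.isScalarTower_int_rat`)
  haveI := endAlgebra.isScalarTower_int_rat A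
  haveI := endAlgebra.isScalarTower_int_rat B
  let Φ : A.endAlgebra →ₐ[ℚ] B.endAlgebra :=
    Algebra.TensorProduct.lift (Algebra.ofId ℚ _)
      { Φ₀ with
        commutes' := fun k ↦ RingHom.congr_fun (RingHom.ext_int
          (Φ₀.comp (algebraMap ℤ (End A))) (algebraMap ℤ _)) k }
      fun q _ ↦ Algebra.commute_algebraMap_left q _
  let Ψ : B.endAlgebra →ₐ[ℚ] A.endAlgebra :=
    Algebra.TensorProduct.lift (Algebra.ofId ℚ _)
      { Ψ₀ with
        commutes' := fun k ↦ RingHom.congr_fun (RingHom.ext_int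
          (Ψ₀.comp (algebraMap ℤ (End B))) (algebraMap ℤ _)) k }
      fun q _ ↦ Algebra.commute_algebraMap_left q _
  have hΦ : ∀ α : End A, Φ (endAlgebra.of A α) =
      (n : ℚ)⁻¹ • endAlgebra.of B (End.of (v ≫ End.asHom α ≫ u)) := fun α => by
    rw [← hΦ₀]
    change Algebra.TensorProduct.lift _ _ _ ((1 : ℚ) ⊗ₜ[ℤ] α) = _
    rw [Algebra.TensorProduct.lift_tmul, map_one, one_mul]
    rfl
  have hΨ : ∀ β : End B, Ψ (endAlgebra.of B β) =
      (n : ℚ)⁻¹ • endAlgebra.of A (End.of (u ≫ End.asHom β ≫ v)) := fun β => by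
    rw [← hΨ₀]
    change Algebra.TensorProduct.lift _ _ _ ((1 : ℚ) ⊗ₜ[ℤ] β) = _
    rw [Algebra.TensorProduct.lift_tmul, map_one, one_mul]
    rfl
  -- the two composites are the identity: `n⁻² · (u v) α (u v) = α`
  have hΨΦ : ∀ x, Ψ (Φ x) = x := by
    intro x
    obtain ⟨M, F, -, rfl⟩ := endAlgebra.exists_eq_algebraMap_mul_of x
    rw [map_mul, map_mul, AlgHom.commutes, AlgHom.commutes, hΦ, map_smul, hΨ,
      conj_conj_eq_nsmul u v huv, map_nsmul, ← Nat.cast_smul_eq_nsmul ℚ, smul_smul, smul_smul,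
      Nat.cast_mul, hnn, one_smul]
  have hΦΨ : ∀ y, Φ (Ψ y) = y := by
    intro y
    obtain ⟨M, G, -, rfl⟩ := endAlgebra.exists_eq_algebraMap_mul_of y
    rw [map_mul, map_mul, AlgHom.commutes, AlgHom.commutes, hΨ, map_smul, hΦ,
      conj_conj_eq_nsmul v u hvu, map_nsmul, ← Nat.cast_smul_eq_nsmul ℚ, smul_smul, smul_smul,
      Nat.cast_mul, hnn, one_smul]
  refine ⟨AlgEquiv.ofAlgHom Φ Ψ (AlgHom.ext hΦΨ) (AlgHom.ext hΨΦ), fun α => hΦ α, fun β => ?_⟩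
  change Ψ (endAlgebra.of B β) = _
  exact hΨ β

/-- **`End⁰` is an isogeny invariant**: an isogeny `u : A → B` yields a `ℚ`-algebra isomorphism
`End⁰(A) ≃ₐ[ℚ] End⁰(B)` (conjugation by `u`, with the quasi-inverse of
`IsIsogeny.exists_nsmul_inverse_holds`). [cite: MumfordAV1970, §19 Remark p. 169 and pp. 172–174]
[cite: Milne1986AbelianVarieties, §12 p. 122] -/
theorem IsIsogeny.nonempty_endAlgebra_algEquiv {u : A ⟶ B} (hu : IsIsogeny u) :
    Nonempty (A.endAlgebra ≃ₐ[ℚ] B.endAlgebra) := by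
  obtain ⟨v, n, hn, huv, hvu⟩ := IsIsogeny.exists_nsmul_inverse_holds hu
  obtain ⟨e, -, -⟩ := exists_endAlgebra_algEquiv_of_nsmul_inverse u v hn huv hvu
  exact ⟨e⟩

/-- **Isogenous abelian varieties have isomorphic endomorphism algebras** `End⁰(A) ≃ₐ[ℚ] End⁰(B)`.
[cite: MumfordAV1970, §19 Remark p. 169 and pp. 172–174] [cite: Milne1986AbelianVarieties, §12 p. 122] -/
theorem IsIsogenous.nonempty_endAlgebra_algEquiv (h : IsIsogenous A B) :
    Nonempty (A.endAlgebra ≃ₐ[ℚ] B.endAlgebra) := by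
  obtain ⟨u, hu⟩ := h
  exact hu.nonempty_endAlgebra_algEquiv

/-- `[End⁰(A) : ℚ] = [End⁰(B) : ℚ]` for isogenous `A`, `B`. [cite: Milne1986AbelianVarieties, §12 p. 122] -/
theorem IsIsogenous.finrank_endAlgebra_eq (h : IsIsogenous A B) :
    Module.finrank ℚ A.endAlgebra = Module.finrank ℚ B.endAlgebra := by
  obtain ⟨e⟩ := h.nonempty_endAlgebra_algEquiv
  exact e.toLinearEquiv.finrank_eq

/-- `End⁰(A)` is a field iff `End⁰(B)` is, for isogenous `A`, `B`. [cite: Milne1986AbelianVarieties, §12 p. 122] -/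
theorem IsIsogenous.isField_endAlgebra_iff (h : IsIsogenous A B) :
    IsField A.endAlgebra ↔ IsField B.endAlgebra := by
  obtain ⟨e⟩ := h.nonempty_endAlgebra_algEquiv
  exact ⟨fun hA => MulEquiv.isField hA e.symm.toMulEquiv, fun hB => MulEquiv.isField hB e.toMulEquiv⟩

/-- `End⁰(A)` is commutative iff `End⁰(B)` is, for isogenous `A`, `B`. [cite: Milne1986AbelianVarieties, §12 p. 122] -/
theorem IsIsogenous.endAlgebra_comm_iff (h : IsIsogenous A B) :
    (∀ x y : A.endAlgebra, x * y = y * x) ↔ ∀ x y : B.endAlgebra, x * y = y * x := by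
  obtain ⟨e⟩ := h.nonempty_endAlgebra_algEquiv
  refine ⟨fun hA x y => ?_, fun hB x y => ?_⟩
  · rw [← e.apply_symm_apply x, ← e.apply_symm_apply y, ← map_mul, hA, map_mul]
  · rw [← e.symm_apply_apply x, ← e.symm_apply_apply y, ← map_mul, hB, map_mul]

end AbelianVariety

end Literature.AlgebraicGeometry.Motives

end
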